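import Mathlib
import Literature.NumberTheory.Transcendental.Associators
import HarnessLib

/-!
# `PentagonInKZ`, line `logfree-gauge-corner-flatness`: stub `omegaCommute_cubical`

Stub `omegaCommute_cubical` of the crux `PentagonInKZ` (stmt-KontsevichZagierPeriods-11348, route
FurushoPentagon): flatness of the KZ connection on the pentagon cell in the cubical chart.

In the cubical chart `(x, y)` of the cell `0 < u < v < 1` of `M_{0,5}(ℝ)` (`x = u/v`, `y = v`) the
KZ connection is `Ω = a dlog x + c dlog(1−x) + p dlog y + e dlog(1−y) + d dlog(1−xy)` with
`a = t₀₁, b = t₀₂, c = t₁₂, d = t₁₃, e = t₂₃, p = a + b + c` in the truncated Drinfeld–Kohno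
algebra `DrinfeldKohnoTrunc R (Fin 4) N`. Its components
`Ω_x = a/x + c/(x−1) + d·y/(xy−1)` and `Ω_y = p/y + e/(y−1) + d·x/(xy−1)` commute at every
rational point off the divisors `x = 0, 1`, `y = 0, 1`, `xy = 1`.

Proof: expand `Ω_x Ω_y − Ω_y Ω_x` bilinearly; the infinitesimal braid relations
`[a, b + c] = 0`, `[c, a + b] = 0`, `[c, d + e] = 0`, `[d, c + e] = 0` and locality `[a, e] = 0`,
`[b, d] = 0` reduce it to a single bracket `[c, d]` whose coefficient is the rational function
`−1/((x−1)(y−1)) + x/((x−1)(xy−1)) + y/((y−1)(xy−1)) − 1/(xy−1) = 0`. The bookkeeping is the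
abstract lemma `OmegaCommute.commute_of_rel` (any algebra, six commutation relations, two scalar
identities), closed by `linear_combination` + `module`.

References: V. G. Drinfeld, *On quasitriangular quasi-Hopf algebras and on a group that is closely
connected with Gal(ℚ̄/ℚ)*, Leningrad Math. J. 2 (1991), §2 (the KZ system on `M_{0,5}` and its
integrability); H. Furusho, *Double shuffle relation for associators*, Ann. of Math. 174 (2011), §2.
-/

noncomputable section

open Literature.NumberTheory.Transcendental

namespace Summit.KontsevichZagierPeriods.FurushoPentagon.PentagonInKZ

namespace OmegaCommute

/-- Abstract form of the flatness computation: in any algebra `S` over a commutative ring `R`, if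
`a, b, c, d, e` satisfy the six (infinitesimal-braid / locality) relations `[a, b + c] = 0`,
`[a, e] = 0`, `[c, a + b] = 0`, `[b, d] = 0`, `[c, d + e] = 0`, `[d, c + e] = 0`, and the scalars
satisfy `α ζ = s = γ δ` and `β ζ + γ ε = β ε + s`, then
`α a + β c + γ d` commutes with `δ (a + b + c) + ε e + ζ d`. [cite: Drinfeld1991, §2] -/
theorem commute_of_rel {R S : Type*} [CommRing R] [Ring S] [Algebra R S] (a b c d e : S)
    (α β γ δ ε ζ s : R)
    (h1 : a * (b + c) = (b + c) * a) (h2 : a * e = e * a) (h3 : c * (a + b) = (a + b) * c)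
    (h4 : b * d = d * b) (h5 : c * (d + e) = (d + e) * c) (h6 : d * (c + e) = (c + e) * d)
    (h7 : α * ζ = s) (h7' : γ * δ = s) (h8 : β * ζ + γ * ε = β * ε + s) :
    Commute (α • a + β • c + γ • d) (δ • (a + b + c) + ε • e + ζ • d) := by
  change (α • a + β • c + γ • d) * (δ • (a + b + c) + ε • e + ζ • d) =
    (δ • (a + b + c) + ε • e + ζ • d) * (α • a + β • c + γ • d)
  linear_combination (norm := skip) (α * δ) • h1 + (α * ε) • h2 + (β * δ) • h3 - (γ * δ) • h4 +
    (β * ε) • h5 + (γ * ε) • h6 + h7 • (a * d - d * a) - h7' • (a * d - d * a) +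
    h8 • (c * d - d * c) - h7' • (c * d - d * c)
  simp only [mul_add, add_mul, smul_mul_assoc, mul_smul_comm, smul_add]
  module

end OmegaCommute

open OmegaCommute in
/-- **Stub `omegaCommute_cubical`.** Flatness of the KZ connection on the pentagon cell in the
cubical chart: with `a = t₀₁, b = t₀₂, c = t₁₂, d = t₁₃, e = t₂₃, p = a + b + c`, the components
`Ω_x = a/x + c/(x−1) + d·y/(xy−1)` and `Ω_y = p/y + e/(y−1) + d·x/(xy−1)` commute in
`DrinfeldKohnoTrunc R (Fin 4) N` at every rational point off the divisors.
[cite: Drinfeld1991, §2] -/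
theorem omegaCommute_cubical : ∀ (R : Type) [CommRing R] [Algebra ℚ R] (N : ℕ) (x y : ℚ), x ≠ 0 → y ≠ 0 → x ≠ 1 → y ≠ 1 → x * y ≠ 1 → Commute ((algebraMap ℚ R (1 / x)) • DrinfeldKohnoTrunc.t R N (0 : Fin 4) 1 + (algebraMap ℚ R (1 / (x - 1))) • DrinfeldKohnoTrunc.t R N (1 : Fin 4) 2 + (algebraMap ℚ R (y / (x * y - 1))) • DrinfeldKohnoTrunc.t R N (1 : Fin 4) 3) ((algebraMap ℚ R (1 / y)) • (DrinfeldKohnoTrunc.t R N (0 : Fin 4) 1 + DrinfeldKohnoTrunc.t R N (0 : Fin 4) 2 + DrinfeldKohnoTrunc.t R N (1 : Fin 4) 2) + (algebraMap ℚ R (1 / (y - 1))) • DrinfeldKohnoTrunc.t R N (2 : Fin 4) 3 + (algebraMap ℚ R (x / (x * y - 1))) • DrinfeldKohnoTrunc.t R N (1 : Fin 4) 3) := by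
  intro R _ _ N x y hx hy hx1 hy1 hxy
  have hx1' : x - 1 ≠ 0 := sub_ne_zero.2 hx1
  have hy1' : y - 1 ≠ 0 := sub_ne_zero.2 hy1
  have hxy' : x * y - 1 ≠ 0 := sub_ne_zero.2 hxy
  refine commute_of_rel (R := R) (S := DrinfeldKohnoTrunc R (Fin 4) N)
    (DrinfeldKohnoTrunc.t R N 0 1) (DrinfeldKohnoTrunc.t R N 0 2) (DrinfeldKohnoTrunc.t R N 1 2)
    (DrinfeldKohnoTrunc.t R N 1 3) (DrinfeldKohnoTrunc.t R N 2 3) _ _ _ _ _ _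
    (algebraMap ℚ R (1 / (x * y - 1))) ?_ ?_ ?_ ?_ ?_ ?_ ?_ ?_ ?_
  · -- `[t₀₁, t₀₂ + t₁₂] = 0`
    exact DrinfeldKohnoTrunc.t_mul_add 0 1 2 (by decide) (by decide) (by decide)
  · -- locality `[t₀₁, t₂₃] = 0`
    exact DrinfeldKohnoTrunc.t_comm 0 1 2 3 (by decide) (by decide) (by decide) (by decide)
      (by decide) (by decide)
  · -- `[t₁₂, t₀₁ + t₀₂] = 0`
    have h := DrinfeldKohnoTrunc.t_mul_add (R := R) (N := N) (1 : Fin 4) 2 0 (by decide)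
      (by decide) (by decide)
    rwa [DrinfeldKohnoTrunc.t_symm (1 : Fin 4) 0, DrinfeldKohnoTrunc.t_symm (2 : Fin 4) 0] at h
  · -- locality `[t₀₂, t₁₃] = 0`
    exact DrinfeldKohnoTrunc.t_comm 0 2 1 3 (by decide) (by decide) (by decide) (by decide)
      (by decide) (by decide)
  · -- `[t₁₂, t₁₃ + t₂₃] = 0`
    exact DrinfeldKohnoTrunc.t_mul_add 1 2 3 (by decide) (by decide) (by decide)
  · -- `[t₁₃, t₁₂ + t₂₃] = 0`
    have h := DrinfeldKohnoTrunc.t_mul_add (R := R) (N := N) (1 : Fin 4) 3 2 (by decide)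
      (by decide) (by decide)
    rwa [DrinfeldKohnoTrunc.t_symm (3 : Fin 4) 2] at h
  · rw [← map_mul]
    congr 1
    field_simp
  · rw [← map_mul]
    congr 1
    field_simp
  · rw [← map_mul, ← map_mul, ← map_mul, ← map_add, ← map_add]
    congr 1
    field_simp
    ring

end Summit.KontsevichZagierPeriods.FurushoPentagon.PentagonInKZ
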